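import Literature.Computability.AlgebraicComplexity.CKSV22PerturbationHeight
import Literature.Computability.AlgebraicComplexity.CKSV22UnlayeredABPRobustBound
import Mathlib.RingTheory.MvPolynomial.EulerIdentity
import HarnessLib

/-!
# CKSV 2022, §1.5 closing remark for homogeneous polynomials: ABP lower bounds from the codimension of `𝕍(∂f)` alone

P. Chatterjee, M. Kumar, A. She, B. L. Volk, *Quadratic lower bounds for algebraic branching programs
and formulas*, comput. complex. **31** (2022) 8 (arXiv:1911.11793), §1.5 (TeX L205): "In general,
these lower bounds hold for any family of polynomials of high enough degree whose zeroes of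
multiplicity at least two lie in a low dimensional variety, or more formally, an analog of Claim 9
or Lemma 24 is true."

For a HOMOGENEOUS `f` of degree `d ≥ 2` the robust hypothesis ("an analog of Lemma 24") follows
from the plain one ("an analog of Claim 9 / Lemma 21") by CKSV Lemma 25 (tree:
`CKSV2022.lemma_25_height'`, file `CKSV22PerturbationHeight`): the partials `∂_i f` are
homogeneous of degree `d − 1`, and perturbations of degree `≤ d − 2` do not lower the minimal height
of primes above them. Hence (assembled in this tree, 0 facts):

* `CKSV2022.robustHeight_of_isHomogeneous` — `f` homogeneous of degree `d ≥ 2`, every prime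
  `⊇ (∂_i f : i)` of height `≥ c` ⟹ every prime `⊇ (∂_i f − g_i : i)`, `deg g_i ≤ d − 2`, has height
  `≥ c`.
* `CKSV2022.thm_7_of_isHomogeneous` — CKSV Thm. 7 for such `f`: ABPs with labels of degree `≤ Δ`
  and formal degree `≤ d` computing `f + Σ_{j<r} A_jB_j + R` (`A_j(0) = B_j(0) = 0`, `deg R < d`)
  have `(⌊d/Δ⌋ − 1)·c ≤ 2k + 2(⌊d/Δ⌋ − 1)·r`.
* `CKSV2022.thm_2_of_isHomogeneous` — CKSV Thm. 2 / Cor. 20 for such `f`: unlayered ABPs with `m`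
  edges and labels of degree `≤ Δ` computing `f` have
  `c·log₂ d ≤ 4m·(log₂ log₂ d + log₂ Δ + 4 + a)` (`16Δ log₂ d ≤ d`, `c ≤ 2^a d`).

## References
* [ChatterjeeKumarSheVolk2022] — §1.5 (closing remark), Lemma 25, Thm. 7, Thm. 2 / Cor. 20.
-/

noncomputable section

open MvPolynomial Finset

namespace Literature.Computability.AlgebraicComplexity

namespace CKSV2022

open Kumar2019

variable {K : Type*} [Field K]

/-- **Robust from plain, for homogeneous `f`** (CKSV Lemma 25 applied to the partials): if `f` is
homogeneous of degree `d ≥ 2` and every prime containing all `∂_i f` has height `≥ c`, then every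
prime containing all `∂_i f − g_i` with `deg g_i ≤ d − 2` has height `≥ c`.
[cite: ChatterjeeKumarSheVolk2022, Lemma 25 and §1.5 (closing remark)] -/
theorem robustHeight_of_isHomogeneous {n d c : ℕ} (hd : 2 ≤ d) {f : MvPolynomial (Fin n) K}
    (hf : f.IsHomogeneous d)
    (hc : ∀ P : Ideal (MvPolynomial (Fin n) K), P.IsPrime → (∀ i, pderiv i f ∈ P) →
      (c : ℕ∞) ≤ P.height)
    (g : Fin n → MvPolynomial (Fin n) K) (hg : ∀ i, (g i).totalDegree ≤ d - 2)
    (P : Ideal (MvPolynomial (Fin n) K)) (hP : P.IsPrime) (hle : ∀ i, pderiv i f - g i ∈ P) :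
    (c : ℕ∞) ≤ P.height := by
  refine lemma_25_height' (fun i => pderiv i f) (fun i => -g i) (fun _ => d - 1)
    (fun i => hf.pderiv) (fun i => ?_) hc P (fun i => by rw [← sub_eq_add_neg]; exact hle i)
  rw [totalDegree_neg]
  exact lt_of_le_of_lt (hg i) (by omega)

/-- **CKSV Thm. 7 for a homogeneous `f` from `codim 𝕍(∂f) ≥ c` alone** (labels of degree `≤ Δ`,
formal degree `≤ d`): `(⌊d/Δ⌋ − 1)·c ≤ 2k + 2(⌊d/Δ⌋ − 1)·r`. Assembled in this tree
(`thm_7_of_robustHeight` + `robustHeight_of_isHomogeneous`).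
[cite: ChatterjeeKumarSheVolk2022, Theorem 7 and §1.5 (closing remark)] -/
theorem thm_7_of_isHomogeneous {n d k r Δ c : ℕ} (hd : 2 ≤ d) (hΔ : 1 ≤ Δ)
    {f : MvPolynomial (Fin n) K} (hf : f.IsHomogeneous d)
    (hc : ∀ P : Ideal (MvPolynomial (Fin n) K), P.IsPrime → (∀ i, pderiv i f ∈ P) →
      (c : ℕ∞) ≤ P.height)
    (A B : Fin r → MvPolynomial (Fin n) K)
    (hA0 : ∀ j, constantCoeff (A j) = 0) (hB0 : ∀ j, constantCoeff (B j) = 0)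
    (R : MvPolynomial (Fin n) K) (hRd : R.totalDegree < d)
    (h : Kumar2019.ABPDegFormalDegreeComputes k Δ d (f + ∑ j, A j * B j + R)) :
    (d / Δ - 1) * c ≤ 2 * k + 2 * (d / Δ - 1) * r :=
  thm_7_of_robustHeight hΔ (robustHeight_of_isHomogeneous hd hf hc) A B hA0 hB0 R hRd h

/-- **CKSV Thm. 2 / Cor. 20 for a homogeneous `f` from `codim 𝕍(∂f) ≥ c` alone**: unlayered ABPs
with `m` edges and labels of degree `≤ Δ` computing `f` (homogeneous of degree `d ≥ 2`) satisfy
`c·log₂ d ≤ 4m·(log₂ log₂ d + log₂ Δ + 4 + a)` whenever `16Δ log₂ d ≤ d` and `c ≤ 2^a d`.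
Assembled in this tree (`thm_2_of_robustHeight` + `robustHeight_of_isHomogeneous`).
[cite: ChatterjeeKumarSheVolk2022, Theorem 2, Corollary 20 and §1.5 (closing remark)] -/
theorem thm_2_of_isHomogeneous {n d c a Δ τ m : ℕ} (hd : 2 ≤ d) (hΔ : 1 ≤ Δ)
    {f : MvPolynomial (Fin n) K} (hf : f.IsHomogeneous d)
    (hc : ∀ P : Ideal (MvPolynomial (Fin n) K), P.IsPrime → (∀ i, pderiv i f ∈ P) →
      (c : ℕ∞) ≤ P.height)
    (hbig : 16 * Δ * Nat.log 2 d ≤ d) (hcd : c ≤ 2 ^ a * d)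
    (h : UnlayeredABPComputes τ m Δ f) :
    c * Nat.log 2 d ≤ 4 * m * (Nat.log 2 (Nat.log 2 d) + Nat.log 2 Δ + 4 + a) := by
  have hf0 : constantCoeff f = 0 := by
    have h0 := hf.coeff_eq_zero (d := 0) (by rw [map_zero]; omega)
    rw [constantCoeff_eq]
    exact h0
  exact thm_2_of_robustHeight hf0 hd hΔ hbig hcd (robustHeight_of_isHomogeneous hd hf hc) h

end CKSV2022

end Literature.Computability.AlgebraicComplexity

end
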